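import Literature.NumberTheory.GaloisRepresentations.LubinTateLogarithmicCoordinate
import Literature.NumberTheory.GaloisRepresentations.LubinTateLogarithm
import Literature.NumberTheory.GaloisRepresentations.LubinTateColemanLogDeriv
import HarnessLib

/-!
# The Lubin–Tate logarithm and the invariant differential: `λ_f′ · ω_f = 1`, and the Lubin–Tate-side
# moments `[X⁰] (ω_f · d/dX)^[k] h = k! · [z^k] (h ∘ e_f)` as Taylor coefficients in `z = λ_f(X)`

Topic `NumberTheory/GaloisRepresentations`; namespace `Literature.NumberTheory.GaloisRepresentations.LubinTate`
(instantiation of `LubinTateLogarithmicCoordinate.lean` on the tree's `ltLog hπ ∈ F⟦X⟧` (`LubinTateLogarithm.lean`: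
`λ ∘ f = π·λ`, `λ ≡ X`) and `invDiff` (`LubinTateInvariantDifferential.lean` / `LubinTateColemanLogDeriv.lean`:
`ω · f′ = π · ω ∘ f`, docstring "`ω_F = 1/λ_f′`") for `f = πX + X^q` over a non-archimedean local field `F`).

De Shalit, *Iwasawa theory of elliptic curves with complex multiplication* (1987), I §3.5 (p. 18):
"Let `D = (Ω/λ′(T)) d/dT` be the translation invariant derivation of `F_f`"; II §4.10 (p. 64) line 2:
`((Ω_p/λ′(t)) d/dt)^k log g_{e(𝔞)}(t)|_{t=0} = Ω_p^k · (d/dz)^k log Θ(Ω − z; L, 𝔞)|_{z=0}` (with II §4.9: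
`g_{e(𝔞)} = P ∘ λ_Ê`).  Proved here (0 sorry, no definitions):

* ★ `derivative_ltLog_mul_invDiff` **`λ_f′ · ω_f = 1`** over `F` (`derivative_log_mul_invDiff_eq_one` with the
  tree's functional equations `subst_ltPolyF_ltLog`, `invDiff_mul_derivative_ltSer`), and over any `F`-algebra;
* ★★ `constantCoeff_iterate_invDiff_derivation_eq_factorial_mul_coeff` **`[X⁰] (ω_f·d/dX)^[k] h = k!·[z^k](h ∘ e_f)`**
  for `h` over any `F`-algebra `B` (`e_f = λ_f⁻¹`, Mathlib `substInvOfIsUnit`), and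
  ★★ `map_constantCoeff_iterate_invDiff_derivation` — the same for `h ∈ 𝒪[F]⟦X⟧` read in `B`: the
  Coates–Wiles value `[X⁰] (invDeriv hπ ^ k) h` (`LubinTateCoatesWilesHom`, `iterate_invDeriv_eq_pow`) read in
  `B` is `k! · [z^k] (h^j ∘ e_f)`, and ★★★ `map_constantCoeff_iterate_invDiff_derivation_logDeriv` — for
  `h = δg = logDeriv hπ g`: **`j(φ_{k+1}(g)) = k! · [z^k] dlog (g^j ∘ e_f)`** (`= (d/dz)^{k+1} log (g ∘ e_f)(0)`);
  and the same over any intermediate coefficient ring `T = 𝒪_E` (`…_of_comp`, `…_dlog_of_comp`: the relative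
  Coates–Wiles values `φ^{CW,E}_{k+1}` of `LubinTateColemanRelativeCoatesWilesTwo`).

Cell `bsd-print-cf2`, width seat `bsd-line-cf2c-w4` g11 (measure lane of de Shalit II.4 at `p = 2`, brick B6).

## References

* [deShalit1987] E. de Shalit, *Iwasawa theory of elliptic curves with complex multiplication*,
  Perspectives in Math. 3 (1987), Ch. I §1.2, §3.5 (p. 18), II §4.9 (p. 62–63), II §4.10 (p. 64).
* [LubinTate1965] J. Lubin, J. Tate, *Formal complex multiplication in local fields*, Ann. of Math. 81
  (1965), §1 Lemma 1.
-/

noncomputable section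

open PowerSeries

namespace Literature.NumberTheory.GaloisRepresentations

namespace LubinTate

/-- `d⁄dX` commutes with coefficientwise maps. [folklore] -/
private theorem derivative_map' {A T : Type*} [CommRing A] [CommRing T] (φ : A →+* T) (G : A⟦X⟧) :
    d⁄dX T (G.map φ) = (d⁄dX A G).map φ := by
  ext n
  simp only [coeff_derivative, coeff_map, map_mul, map_add, map_natCast, map_one]

/-! ### §2 The Lubin–Tate logarithm: `λ_f′ · ω_f = 1`, and the moments as Taylor coefficients in `z = λ_f` -/

section LubinTateLog

open ValuativeRel IsLocalRing Field IsNonarchimedeanLocalField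

variable {F : Type} [Field F] [ValuativeRel F] [TopologicalSpace F] [IsNonarchimedeanLocalField F]

attribute [local instance] ltNormUniformSpace ltNormIsUniformAddGroup rk1 nF nE fintypeResidueField

variable {π : 𝒪[F]} (hπ : (valuation F).IsUniformizer (π : F))

/-- `f = πX + X^q` read over `F` through `LTCoeff F` is `ltPolyF` (unfolding). [folklore] -/
private theorem map_ltSer_eq_ltPolyF :
    (ltSer F π).map ((algebraMap 𝒪[F] F).comp (LTCoeff.of F).symm.toRingHom) = ltPolyF F π := by
  ext n
  rw [coeff_map, ltPolyF, coeff_map]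
  rfl

/-- `ω_f · f′ = π · ω_f ∘ f` read over the field `F` (`invDiff_mul_derivative_ltSer`, mapped).
[cite: deShalit1987, Ch. I §3.5 (p. 18)] -/
theorem map_invDiff_mul_derivative_ltPolyF :
    (invDiff (isLTRing_LTCoeff hπ) (isLTSeries_LTCoeff π)).map
          ((algebraMap 𝒪[F] F).comp (LTCoeff.of F).symm.toRingHom) * d⁄dX F (ltPolyF F π) =
      C ((π : 𝒪[F]) : F) *
        ((invDiff (isLTRing_LTCoeff hπ) (isLTSeries_LTCoeff π)).map
          ((algebraMap 𝒪[F] F).comp (LTCoeff.of F).symm.toRingHom)).subst (ltPolyF F π) := by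
  have hs : HasSubst (ltSer F π) :=
    HasSubst.of_constantCoeff_zero' (isLTSeries_LTCoeff π).constantCoeff_eq_zero
  have h := congrArg (PowerSeries.map ((algebraMap 𝒪[F] F).comp (LTCoeff.of F).symm.toRingHom))
    (invDiff_mul_derivative_ltSer (F := F) hπ)
  rw [map_mul, map_mul, ← derivative_map', map_C, map_subst_one' _ hs, map_ltSer_eq_ltPolyF] at h
  exact h

/-- ★ **`λ_f′ · ω_f = 1`**: the invariant differential IS `1/λ_f′` (the defining sentence of de Shalit's
`D = (1/λ′) d/dX`; docstring of `LubinTate.invDiff`).  Proof: `P = λ′·ω` satisfies `P ∘ f = P` by the two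
functional equations `λ ∘ f = πλ`, `ω·f′ = π·ω ∘ f`, and `P(0) = 1`; a series fixed by `X ↦ f(X)` is
constant (`twisted_rigidity` with `φ = id`, as `π^n ≠ 1`). [cite: deShalit1987, Ch. I §3.5 (p. 18), §1.2] -/
theorem derivative_ltLog_mul_invDiff :
    d⁄dX F (ltLog hπ) *
        (invDiff (isLTRing_LTCoeff hπ) (isLTSeries_LTCoeff π)).map
          ((algebraMap 𝒪[F] F).comp (LTCoeff.of F).symm.toRingHom) = 1 :=
  derivative_log_mul_invDiff_eq_one (isLTSeries_ltPolyF (F := F) (π := π)).constantCoeff_eq_zero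
    (isLTSeries_ltPolyF (F := F) (π := π)).coeff_one (coeff_one_ltLog hπ) (subst_ltPolyF_ltLog hπ)
    (by rw [← coeff_zero_eq_constantCoeff_apply, coeff_map, coeff_zero_eq_constantCoeff_apply,
      constantCoeff_invDiff, map_one])
    (map_invDiff_mul_derivative_ltPolyF hπ) (isLTRing_field F hπ).eq_zero_of_mul_eq_zero
    (fun n hn => (isLTRing_field F hπ).isUnit_one_sub_pow n hn)

/-- `λ_f′ · ω_f = 1` read in any `F`-algebra `B`. [cite: deShalit1987, Ch. I §3.5 (p. 18)] -/
theorem derivative_map_ltLog_mul_invDiff {B : Type*} [CommRing B] [Algebra F B] :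
    d⁄dX B ((ltLog hπ).map (algebraMap F B)) *
        (invDiff (isLTRing_LTCoeff hπ) (isLTSeries_LTCoeff π)).map
          ((algebraMap F B).comp ((algebraMap 𝒪[F] F).comp (LTCoeff.of F).symm.toRingHom)) = 1 := by
  have h := congrArg (PowerSeries.map (algebraMap F B)) (derivative_ltLog_mul_invDiff hπ)
  rw [map_mul, map_one, ← derivative_map', ← RingHom.comp_apply (PowerSeries.map (algebraMap F B))
    (PowerSeries.map ((algebraMap 𝒪[F] F).comp (LTCoeff.of F).symm.toRingHom)), ← PowerSeries.map_comp] at h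
  exact h

/-- `λ_f ≡ X (mod deg 2)` in any `F`-algebra: its linear coefficient is a unit, so `e_f = λ_f⁻¹` exists.
[cite: LubinTate1965, §1 Lemma 1] -/
theorem isUnit_coeff_one_map_ltLog {B : Type*} [CommRing B] [Algebra F B] :
    IsUnit (coeff 1 ((ltLog hπ).map (algebraMap F B))) := by
  rw [coeff_map, coeff_one_ltLog, map_one]
  exact isUnit_one

/-- `λ_f(0) = 0` in any `F`-algebra. [cite: LubinTate1965, §1 Lemma 1] -/
theorem constantCoeff_map_ltLog {B : Type*} [CommRing B] [Algebra F B] :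
    constantCoeff ((ltLog hπ).map (algebraMap F B)) = 0 := by
  rw [← coeff_zero_eq_constantCoeff_apply, coeff_map, coeff_zero_eq_constantCoeff_apply, constantCoeff_ltLog,
    map_zero]

/-- ★★ **The Lubin–Tate-side moments are Taylor coefficients in the logarithmic coordinate**: for every
`F`-algebra `B` and every `h ∈ B⟦X⟧`,
`[X⁰] (ω_f · d/dX)^[k] h = k! · [z^k] (h ∘ e_f)`, `e_f = λ_f⁻¹` (de Shalit II §4.10 line 2:
`((Ω_p/λ′(t)) d/dt)^k (·)|_{t=0} = Ω_p^k (d/dz)^k (· ∘ e)|_{z=0}`, the `Ω_p^k` being the comparison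
`LubinTateComparisonDerivation`). [cite: deShalit1987, II §4.9 (p. 62–63), II §4.10 (p. 64)] -/
theorem constantCoeff_iterate_invDiff_derivation_eq_factorial_mul_coeff {B : Type*} [CommRing B] [Algebra F B]
    (k : ℕ) (h : B⟦X⟧) :
    constantCoeff ((fun g : B⟦X⟧ =>
        (invDiff (isLTRing_LTCoeff hπ) (isLTSeries_LTCoeff π)).map
            ((algebraMap F B).comp ((algebraMap 𝒪[F] F).comp (LTCoeff.of F).symm.toRingHom)) *
          d⁄dX B g)^[k] h) =
      (k.factorial : B) *
        coeff k (h.subst (((ltLog hπ).map (algebraMap F B)).substInvOfIsUnit (isUnit_coeff_one_map_ltLog hπ))) :=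
  constantCoeff_iterate_derivation_eq_factorial_mul_coeff_subst_substInv (constantCoeff_map_ltLog hπ)
    (isUnit_coeff_one_map_ltLog hπ) (derivative_map_ltLog_mul_invDiff hπ) k h

/-- ★★ **… for `h ∈ 𝒪[F]⟦X⟧` read in `B`** (the currency of the Coates–Wiles values
`[X⁰] (invDeriv hπ ^ k) h`, `LubinTateCoatesWilesHom` / `LubinTateComparisonDifferentialUnramified`):
`j([X⁰] (ω_f · d/dX)^[k] h) = k! · [z^k] (h^j ∘ e_f)` with `j : 𝒪[F] = LTCoeff F → F → B`.
[cite: deShalit1987, II §4.9 (p. 62–63), II §4.10 (p. 64)] -/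
theorem map_constantCoeff_iterate_invDiff_derivation {B : Type*} [CommRing B] [Algebra F B]
    (k : ℕ) (h : PowerSeries (LTCoeff F)) :
    (algebraMap F B).comp ((algebraMap 𝒪[F] F).comp (LTCoeff.of F).symm.toRingHom)
        (constantCoeff ((fun g : PowerSeries (LTCoeff F) =>
          invDiff (isLTRing_LTCoeff hπ) (isLTSeries_LTCoeff π) * d⁄dX (LTCoeff F) g)^[k] h)) =
      (k.factorial : B) *
        coeff k ((h.map ((algebraMap F B).comp ((algebraMap 𝒪[F] F).comp (LTCoeff.of F).symm.toRingHom))).subst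
          (((ltLog hπ).map (algebraMap F B)).substInvOfIsUnit (isUnit_coeff_one_map_ltLog hπ))) := by
  rw [← constantCoeff_map_iterate_derivation, constantCoeff_iterate_invDiff_derivation_eq_factorial_mul_coeff]

/-- ★★★ **The Coates–Wiles values in the logarithmic coordinate**: for a unit `g ∈ 𝒪[F]⟦X⟧ˣ` and its
Coleman logarithmic derivative `δg = ω_f · g′/g` (`logDeriv hπ g`), read in any `F`-algebra `B` through
`j : 𝒪[F] → F → B`: `j([X⁰] (ω_f · d/dX)^[k] δg) = k! · [z^k] dlog (g^j ∘ e_f)` — i.e. de Shalit's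
`φ_{k+1}(g) = D^{k+1} log g (0)` is `(d/dz)^{k+1} log (g ∘ e_f)(0)`, the form in which II §4.9
(`g_{e(𝔞)} ∘ e = P`, the Taylor series of `Θ(Ω − z; L, 𝔞)`) is consumed.
[cite: deShalit1987, Ch. I §3.5 (11) (p. 18), II §4.9 (p. 62–63), II §4.10 (p. 64)] -/
theorem map_constantCoeff_iterate_invDiff_derivation_logDeriv {B : Type*} [CommRing B] [Algebra F B]
    (k : ℕ) (g : (PowerSeries (LTCoeff F))ˣ) :
    (algebraMap F B).comp ((algebraMap 𝒪[F] F).comp (LTCoeff.of F).symm.toRingHom)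
        (constantCoeff ((fun G : PowerSeries (LTCoeff F) =>
          invDiff (isLTRing_LTCoeff hπ) (isLTSeries_LTCoeff π) * d⁄dX (LTCoeff F) G)^[k] (logDeriv hπ g))) =
      (k.factorial : B) *
        coeff k (PowerSeries.dlog (Units.map (substAlgHom (PowerSeries.HasSubst.of_constantCoeff_zero'
          (PowerSeries.constantCoeff_substInvOfIsUnit ((ltLog hπ).map (algebraMap F B))
            (isUnit_coeff_one_map_ltLog hπ))) : B⟦X⟧ →ₐ[B] B⟦X⟧).toMonoidHom
          (Units.map (PowerSeries.map ((algebraMap F B).comp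
            ((algebraMap 𝒪[F] F).comp (LTCoeff.of F).symm.toRingHom))).toMonoidHom g))) := by
  set jB : LTCoeff F →+* B := (algebraMap F B).comp ((algebraMap 𝒪[F] F).comp (LTCoeff.of F).symm.toRingHom)
    with hjB
  have hmap : (logDeriv hπ g).map jB =
      (invDiff (isLTRing_LTCoeff hπ) (isLTSeries_LTCoeff π)).map jB *
        PowerSeries.dlog (Units.map (PowerSeries.map jB).toMonoidHom g) := by
    rw [logDeriv_def, map_mul, PowerSeries.dlog_eq_of_map_eq jB g _ (by rw [Units.coe_map]; rfl)]
  rw [← constantCoeff_map_iterate_derivation, hmap]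
  exact constantCoeff_iterate_derivation_invLogDeriv_eq_factorial_mul_coeff_dlog (constantCoeff_map_ltLog hπ)
    (isUnit_coeff_one_map_ltLog hπ) (derivative_map_ltLog_mul_invDiff hπ) k _

/-- ★★ **… over any intermediate coefficient ring** (the RELATIVE currency: `h ∈ 𝒪_E⟦X⟧`, `T = 𝒪_E` with
its `𝒪_F`-algebra map `i`, read in an `F`-algebra `B ⊇ E` through `j : 𝒪_E → B` with `j ∘ i = (𝒪_F → F → B)`):
`j([X⁰] (ω_f^i · d/dX)^[k] h) = k! · [z^k] (h^j ∘ e_f)`. [cite: deShalit1987, II §4.9 (p. 62–63), II §4.10 (p. 64)] -/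
theorem map_constantCoeff_iterate_invDiff_derivation_of_comp {T B : Type*} [CommRing T] [CommRing B] [Algebra F B]
    (i : LTCoeff F →+* T) (j : T →+* B)
    (hj : j.comp i = (algebraMap F B).comp ((algebraMap 𝒪[F] F).comp (LTCoeff.of F).symm.toRingHom))
    (k : ℕ) (h : PowerSeries T) :
    j (constantCoeff ((fun G : PowerSeries T =>
        (invDiff (isLTRing_LTCoeff hπ) (isLTSeries_LTCoeff π)).map i * d⁄dX T G)^[k] h)) =
      (k.factorial : B) *
        coeff k ((h.map j).subst (((ltLog hπ).map (algebraMap F B)).substInvOfIsUnit (isUnit_coeff_one_map_ltLog hπ))) := by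
  have hω : ((invDiff (isLTRing_LTCoeff hπ) (isLTSeries_LTCoeff π)).map i).map j =
      (invDiff (isLTRing_LTCoeff hπ) (isLTSeries_LTCoeff π)).map
        ((algebraMap F B).comp ((algebraMap 𝒪[F] F).comp (LTCoeff.of F).symm.toRingHom)) := by
    rw [← RingHom.comp_apply (PowerSeries.map j) (PowerSeries.map i), ← PowerSeries.map_comp, hj]
  rw [← constantCoeff_map_iterate_derivation, hω]
  exact constantCoeff_iterate_invDiff_derivation_eq_factorial_mul_coeff hπ k _

/-- ★★★ **The relative Coates–Wiles values in the logarithmic coordinate**: for a unit `G ∈ 𝒪_E⟦X⟧ˣ` and its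
relative logarithmic derivative `δ_E G = ω_f^i · G′/G` (`relLogDeriv`), read in `B` through `j` (`j ∘ i = 𝒪_F → B`):
`j([X⁰] (ω_f^i · d/dX)^[k] (ω_f^i · dlog G)) = k! · [z^k] dlog (G^j ∘ e_f)` — `φ^{CW,E}_{k+1}(β) = (d/dz)^{k+1} log (g_β ∘ e_f)(0)`.
[cite: deShalit1987, Ch. I §3.5 (11) (p. 18), II §4.9 (p. 62–63), II §4.10 (p. 64)] -/
theorem map_constantCoeff_iterate_invDiff_derivation_dlog_of_comp {T B : Type*} [CommRing T] [CommRing B]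
    [Algebra F B] (i : LTCoeff F →+* T) (j : T →+* B)
    (hj : j.comp i = (algebraMap F B).comp ((algebraMap 𝒪[F] F).comp (LTCoeff.of F).symm.toRingHom))
    (k : ℕ) (G : (PowerSeries T)ˣ) :
    j (constantCoeff ((fun H : PowerSeries T =>
        (invDiff (isLTRing_LTCoeff hπ) (isLTSeries_LTCoeff π)).map i * d⁄dX T H)^[k]
        ((invDiff (isLTRing_LTCoeff hπ) (isLTSeries_LTCoeff π)).map i * PowerSeries.dlog G))) =
      (k.factorial : B) *
        coeff k (PowerSeries.dlog (Units.map (substAlgHom (PowerSeries.HasSubst.of_constantCoeff_zero'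
          (PowerSeries.constantCoeff_substInvOfIsUnit ((ltLog hπ).map (algebraMap F B))
            (isUnit_coeff_one_map_ltLog hπ))) : B⟦X⟧ →ₐ[B] B⟦X⟧).toMonoidHom
          (Units.map (PowerSeries.map j).toMonoidHom G))) := by
  have hω : ((invDiff (isLTRing_LTCoeff hπ) (isLTSeries_LTCoeff π)).map i).map j =
      (invDiff (isLTRing_LTCoeff hπ) (isLTSeries_LTCoeff π)).map
        ((algebraMap F B).comp ((algebraMap 𝒪[F] F).comp (LTCoeff.of F).symm.toRingHom)) := by
    rw [← RingHom.comp_apply (PowerSeries.map j) (PowerSeries.map i), ← PowerSeries.map_comp, hj]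
  have hmap : ((invDiff (isLTRing_LTCoeff hπ) (isLTSeries_LTCoeff π)).map i * PowerSeries.dlog G).map j =
      (invDiff (isLTRing_LTCoeff hπ) (isLTSeries_LTCoeff π)).map
        ((algebraMap F B).comp ((algebraMap 𝒪[F] F).comp (LTCoeff.of F).symm.toRingHom)) *
        PowerSeries.dlog (Units.map (PowerSeries.map j).toMonoidHom G) := by
    rw [map_mul, hω, PowerSeries.dlog_eq_of_map_eq j G _ (by rw [Units.coe_map]; rfl)]
  rw [← constantCoeff_map_iterate_derivation, hω, hmap]
  exact constantCoeff_iterate_derivation_invLogDeriv_eq_factorial_mul_coeff_dlog (constantCoeff_map_ltLog hπ)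
    (isUnit_coeff_one_map_ltLog hπ) (derivative_map_ltLog_mul_invDiff hπ) k _

end LubinTateLog

end LubinTate

end Literature.NumberTheory.GaloisRepresentations

end
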